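import Summits.Schanuel.Schanuel.Theorems.RootDecomp1KResidueDescent04
import Summits.Schanuel.Schanuel.Theorems.RootDecomp1KHyperellipticSiegel02

/-!
# RootDecomp1KResidueDomHyper — census-1 (gen 25) INSTRUMENT CERTIFICATE: the typed-residue exhibits of record
ρ1′ = `rho1'`, ρ2′ = `rho2'` (ERRATUM E5, VERDICT 28 L3071; decided by node 29, VERDICT 29 L3096) and the stratum-ρ3
specimen `rho3` (VERDICT 27 L3050, «toolkit homework») are members of node 23's DOMINANT HYPERELLIPTIC CLASS `DomHyper`
(`RootDecomp1KHyperellipticSiegel02`, K-R54 (i) lane, CLOSED ×0) — hence `LevelFinite` and `ThinFibreAt m₀` for EVERY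
`m₀`, HYPOTHESIS-FREE, by the TREE theorem `thinFibreAt_dom2` (Siegel's theorem for `u² = Δ(Y)`, PROVED in the tree)
BY INSPECTION of three hypotheses: `DomZero 2 c`, `Δ = pDisc c = c₁² − 4c₀c₂` separable over `ℚ`, `3 ≤ deg Δ`.

* ρ1′: `Δ = 68Y⁴ + 68Y³ + Y² + 2Y + 1 = (Y+1)(68Y³+Y+1)`, separable (Bézout: `S·Δ + T·Δ' = 265880`), degree 4.
* ρ2′: `Δ = 68Y³ + 69Y² + 2Y + 1 = (Y+1)(68Y²+Y+1)`, separable (`… = 626552`), degree 3.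
* ρ3:  `Δ = −4Y⁵ + Y⁴ − 12`, separable (`… = 1799952`), degree 5.

The census LIVENESS key `hsE` printed «YES — node 23's engine (E) applies … decided hyp-free» on these rows since they
were tabled (v36 / v38); this file is the kernel form of that cell (ρ1′ / ρ2′: class MEMBERSHIP only — their decisions of record are node 29's
`RootDecomp1KExhibitDescent.thinFibreAt_rho1'` / `thinFibreAt_rho2'`, which `thinFibreAt_of_domHyper` re-derives, shown as
`example`s; ρ3: membership AND the decision, new to the tree).  ×0 (K-R54 (i)); rung 0; nothing here proves
Schanuel, 33364, 33363, 31077, 31987, `ThinFibre 2`, W4 or a binder.  No `private`, no `instance`, no `set_option`,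
no notation, no sorry, no axiom.
-/

noncomputable section

namespace Summit.Schanuel.Schanuel.Theorems.RootDecomp1KResidueDomHyper

open Polynomial
open Summit.Schanuel.Schanuel.Theorems.RootDecomp1KDegreeLadder
open Summit.Schanuel.Schanuel.Theorems.RootDecomp1KXTop
open Summit.Schanuel.Schanuel.Theorems.RootDecomp1KLevelFinite
open Summit.Schanuel.Schanuel.Theorems.RootDecomp1KIntegrality (DomZero)
open Summit.Schanuel.Schanuel.Theorems.RootDecomp1KHeightGrading (BddLevelEmpty)
open Summit.Schanuel.Schanuel.Theorems.RootDecomp1KHyperellipticSiegel (pDisc DomHyper domHyper_xPolyP_iff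
  thinFibreAt_dom2 levelFinite_dom2 bddLevelEmpty_dom2)
open Summit.Schanuel.Schanuel.Theorems.RootDecomp1KSectorTheorem (rho3 rho3_zero rho3_one rho3_two)
open Summit.Schanuel.Schanuel.Theorems.RootDecomp1KResidueDescent (rho1' rho2' rho1'_zero rho1'_one rho1'_two
  rho2'_zero rho2'_one rho2'_two)

/-! ## §1  ρ1′ = `rho1'` = `Y⁴ + Y³ + x·Y + x − 17x²` -/

/-- `Δ(ρ1′) = (Y+1)² + 68(Y⁴+Y³) = 68Y⁴ + 68Y³ + Y² + 2Y + 1`. -/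
theorem pDisc_rho1' : pDisc rho1' = C 68 * X ^ 4 + C 68 * X ^ 3 + X ^ 2 + C 2 * X + 1 := by
  rw [pDisc, rho1'_zero, rho1'_one, rho1'_two]
  simp only [map_neg, map_ofNat, map_one]
  ring

/-- `deg Δ(ρ1′) = 4`. -/
theorem natDegree_pDisc_rho1' : (pDisc rho1').natDegree = 4 := by rw [pDisc_rho1']; compute_degree!

/-- `Δ(ρ1′)` is separable over `ℚ` (Bézout: `S·Δ + T·Δ' = 265880` with `S = −974576z² − 348228z + 253206`,
`T = 243644z³ + 147968z² − 85429z + 6337`). -/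
theorem separable_pDisc_rho1' : ((pDisc rho1').map (Int.castRingHom ℚ)).Separable := by
  rw [Polynomial.separable_def, pDisc_rho1']
  have hV : (C 68 * X ^ 4 + C 68 * X ^ 3 + X ^ 2 + C 2 * X + 1 : ℤ[X]).map (Int.castRingHom ℚ) =
      C 68 * X ^ 4 + C 68 * X ^ 3 + X ^ 2 + C 2 * X + 1 := by
    simp only [Polynomial.map_add, Polynomial.map_mul, Polynomial.map_pow, map_X, map_C, Polynomial.map_one]; rfl
  rw [hV]
  refine (Polynomial.isCoprime_iff_aeval_ne_zero_of_isAlgClosed (k := ℚ) (K := ℂ) _ _).mpr fun z => ?_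
  by_contra h
  simp only [not_or, not_not, derivative_mul, derivative_C, derivative_X_pow, derivative_X,
    derivative_one, zero_mul, zero_add, add_zero, mul_one, map_add, map_mul, map_pow, aeval_X, aeval_C, map_natCast,
    aeval_one] at h
  simp only [eq_ratCast, Rat.cast_ofNat, Nat.cast_ofNat] at h
  obtain ⟨h1, h2⟩ := h
  have : (265880 : ℂ) = 0 := by
    linear_combination (-974576 * z ^ 2 - 348228 * z + 253206) * h1 +
      (243644 * z ^ 3 + 147968 * z ^ 2 - 85429 * z + 6337) * h2
  norm_num at this

/-- DOMINANCE: `deg c₁ = 1 < 4`, `deg c₂ = 0 < 4`. -/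
theorem domZero_rho1' : DomZero 2 rho1' := by
  intro i hi1 hi2
  have h0 : (rho1' 0).natDegree = 4 := by rw [rho1'_zero]; compute_degree!
  rw [h0]
  interval_cases i
  · rw [rho1'_one]; exact lt_of_le_of_lt (by compute_degree) (by norm_num : 1 < 4)
  · rw [rho1'_two, natDegree_C]; norm_num

/-- **ρ1′ ∈ `DomHyper`** (node 23's class, K-R54 (i) lane). -/
theorem domHyper_rho1' : DomHyper (xPolyP 2 rho1') :=
  (domHyper_xPolyP_iff rho1' (by rw [rho1'_two]; exact C_ne_zero.mpr (by norm_num))).mpr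
    ⟨domZero_rho1', separable_pDisc_rho1', by rw [natDegree_pDisc_rho1']; norm_num⟩

/-- node 23 re-derives node 29's `RootDecomp1KExhibitDescent.levelFinite_rho1'` / `thinFibreAt_rho1'` (split
descent) BY INSPECTION — stated as `example`s (the theorems of record are node 29's; no restatement). -/
example : LevelFinite (xPolyP 2 rho1') :=
  levelFinite_dom2 rho1' domZero_rho1' separable_pDisc_rho1' (by rw [natDegree_pDisc_rho1']; norm_num)

example (m₀ : ℕ) : ThinFibreAt m₀ (xPolyP 2 rho1') :=
  thinFibreAt_dom2 rho1' domZero_rho1' separable_pDisc_rho1' (by rw [natDegree_pDisc_rho1']; norm_num) m₀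

/-! ## §2  ρ2′ = `rho2'` = `(Y² − 17x)² − x·Y − x` -/

/-- `Δ(ρ2′) = (34Y²+Y+1)² − 1156Y⁴ = 68Y³ + 69Y² + 2Y + 1`. -/
theorem pDisc_rho2' : pDisc rho2' = C 68 * X ^ 3 + C 69 * X ^ 2 + C 2 * X + 1 := by
  rw [pDisc, rho2'_zero, rho2'_one, rho2'_two]
  simp only [map_neg, map_ofNat, map_one]
  ring

/-- `deg Δ(ρ2′) = 3`. -/
theorem natDegree_pDisc_rho2' : (pDisc rho2').natDegree = 3 := by rw [pDisc_rho2']; compute_degree!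

/-- `Δ(ρ2′)` is separable over `ℚ` (Bézout: `S·Δ + T·Δ' = 626552` with `S = 888012z + 649062`,
`T = −296004z² − 316473z − 11255`). -/
theorem separable_pDisc_rho2' : ((pDisc rho2').map (Int.castRingHom ℚ)).Separable := by
  rw [Polynomial.separable_def, pDisc_rho2']
  have hV : (C 68 * X ^ 3 + C 69 * X ^ 2 + C 2 * X + 1 : ℤ[X]).map (Int.castRingHom ℚ) =
      C 68 * X ^ 3 + C 69 * X ^ 2 + C 2 * X + 1 := by
    simp only [Polynomial.map_add, Polynomial.map_mul, Polynomial.map_pow, map_X, map_C, Polynomial.map_one]; rfl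
  rw [hV]
  refine (Polynomial.isCoprime_iff_aeval_ne_zero_of_isAlgClosed (k := ℚ) (K := ℂ) _ _).mpr fun z => ?_
  by_contra h
  simp only [not_or, not_not, derivative_mul, derivative_C, derivative_X_pow, derivative_X,
    derivative_one, zero_mul, zero_add, add_zero, mul_one, map_add, map_mul, map_pow, aeval_X, aeval_C, map_natCast,
    aeval_one] at h
  simp only [eq_ratCast, Rat.cast_ofNat, Nat.cast_ofNat] at h
  obtain ⟨h1, h2⟩ := h
  have : (626552 : ℂ) = 0 := by
    linear_combination (888012 * z + 649062) * h1 + (-296004 * z ^ 2 - 316473 * z - 11255) * h2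
  norm_num at this

/-- DOMINANCE: `deg c₁ = 2 < 4`, `deg c₂ = 0 < 4`. -/
theorem domZero_rho2' : DomZero 2 rho2' := by
  intro i hi1 hi2
  have h0 : (rho2' 0).natDegree = 4 := by rw [rho2'_zero]; compute_degree!
  rw [h0]
  interval_cases i
  · rw [rho2'_one]; exact lt_of_le_of_lt (by compute_degree) (by norm_num : 2 < 4)
  · rw [rho2'_two, natDegree_C]; norm_num

/-- **ρ2′ ∈ `DomHyper`**. -/
theorem domHyper_rho2' : DomHyper (xPolyP 2 rho2') :=
  (domHyper_xPolyP_iff rho2' (by rw [rho2'_two]; exact C_ne_zero.mpr (by norm_num))).mpr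
    ⟨domZero_rho2', separable_pDisc_rho2', by rw [natDegree_pDisc_rho2']⟩

/-- node 23 re-derives node 29's `levelFinite_rho2'` / `thinFibreAt_rho2'` (square descent) BY INSPECTION. -/
example : LevelFinite (xPolyP 2 rho2') :=
  levelFinite_dom2 rho2' domZero_rho2' separable_pDisc_rho2' (by rw [natDegree_pDisc_rho2'])

example (m₀ : ℕ) : ThinFibreAt m₀ (xPolyP 2 rho2') :=
  thinFibreAt_dom2 rho2' domZero_rho2' separable_pDisc_rho2' (by rw [natDegree_pDisc_rho2']) m₀

/-! ## §3  ρ3 = `rho3` = `x² + x·Y² + Y⁵ + 3` (the stratum-ρ3 specimen, `residue_rho3`) -/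

/-- `Δ(ρ3) = Y⁴ − 4(Y⁵ + 3) = −4Y⁵ + Y⁴ − 12`. -/
theorem pDisc_rho3 : pDisc rho3 = C (-4) * X ^ 5 + X ^ 4 + C (-12) := by
  rw [pDisc, rho3_zero, rho3_one, rho3_two]
  simp only [map_neg, map_ofNat]
  ring

/-- `deg Δ(ρ3) = 5`. -/
theorem natDegree_pDisc_rho3 : (pDisc rho3).natDegree = 5 := by rw [pDisc_rho3]; compute_degree!

/-- `Δ(ρ3)` is separable over `ℚ` (Bézout: `S·Δ + T·Δ' = 1799952` with `S = −500z³ − 149996`,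
`T = 100z⁴ − 5z³ − z² + 29999z − 1500`). -/
theorem separable_pDisc_rho3 : ((pDisc rho3).map (Int.castRingHom ℚ)).Separable := by
  rw [Polynomial.separable_def, pDisc_rho3]
  have hV : (C (-4) * X ^ 5 + X ^ 4 + C (-12) : ℤ[X]).map (Int.castRingHom ℚ) = C (-4) * X ^ 5 + X ^ 4 + C (-12) := by
    simp only [Polynomial.map_add, Polynomial.map_mul, Polynomial.map_pow, map_X, map_C]; rfl
  rw [hV]
  refine (Polynomial.isCoprime_iff_aeval_ne_zero_of_isAlgClosed (k := ℚ) (K := ℂ) _ _).mpr fun z => ?_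
  by_contra h
  simp only [not_or, not_not, derivative_mul, derivative_C, derivative_X_pow,
    zero_mul, zero_add, add_zero, map_add, map_mul, map_pow, aeval_X, aeval_C, map_natCast] at h
  simp only [eq_ratCast, Rat.cast_neg, Rat.cast_ofNat, Nat.cast_ofNat] at h
  obtain ⟨h1, h2⟩ := h
  have : (1799952 : ℂ) = 0 := by
    linear_combination (-500 * z ^ 3 - 149996) * h1 + (100 * z ^ 4 - 5 * z ^ 3 - z ^ 2 + 29999 * z - 1500) * h2
  norm_num at this

/-- DOMINANCE: `deg c₁ = 2 < 5`, `deg c₂ = 0 < 5`. -/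
theorem domZero_rho3 : DomZero 2 rho3 := by
  intro i hi1 hi2
  have h0 : (rho3 0).natDegree = 5 := by rw [rho3_zero]; compute_degree!
  rw [h0]
  interval_cases i
  · rw [rho3_one, natDegree_X_pow]; norm_num
  · rw [rho3_two, natDegree_one]; norm_num

/-- **ρ3 ∈ `DomHyper`**. -/
theorem domHyper_rho3 : DomHyper (xPolyP 2 rho3) :=
  (domHyper_xPolyP_iff rho3 (by rw [rho3_two]; exact one_ne_zero)).mpr
    ⟨domZero_rho3, separable_pDisc_rho3, by rw [natDegree_pDisc_rho3]; norm_num⟩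

/-- **`LevelFinite (xPolyP 2 rho3)` BY NODE 23** (Siegel on `u² = −4Y⁵ + Y⁴ − 12`), hypothesis-free — the ρ3
«homework» specimen is DECIDED OF RECORD by the tree. -/
theorem levelFinite_rho3_dom2 : LevelFinite (xPolyP 2 rho3) :=
  levelFinite_dom2 rho3 domZero_rho3 separable_pDisc_rho3 (by rw [natDegree_pDisc_rho3]; norm_num)

/-- **`ThinFibreAt m₀ (xPolyP 2 rho3)` for EVERY `m₀` BY NODE 23** (in particular at the residue qualities `m₀ ≤ 2`
of `residue_rho3`). -/
theorem thinFibreAt_rho3_dom2 (m₀ : ℕ) : ThinFibreAt m₀ (xPolyP 2 rho3) :=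
  thinFibreAt_dom2 rho3 domZero_rho3 separable_pDisc_rho3 (by rw [natDegree_pDisc_rho3]; norm_num) m₀

/-- `BddLevelEmpty (xPolyP 2 rho3)` (node 12's (b)). -/
theorem bddLevelEmpty_rho3_dom2 : BddLevelEmpty (xPolyP 2 rho3) :=
  bddLevelEmpty_dom2 rho3 domZero_rho3 separable_pDisc_rho3 (by rw [natDegree_pDisc_rho3]; norm_num)

/-! ## §4  The census cell, kernel form -/

/-- **THE CENSUS CELL, KERNEL FORM: the three typed-residue members of record with a separable `Δ` — ρ1′, ρ2′ (the
E5-b exhibits) and ρ3 (the «homework» specimen) — are `DomHyper` members (node 23, K-R54 (i) lane), and ρ3 is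
thereby DECIDED (`ThinFibreAt m₀` for every `m₀`, `LevelFinite`, `BddLevelEmpty`), hypothesis-free.**  (ρ1′ / ρ2′ are
decided of record by node 29's `thinFibreAt_rho1'` / `thinFibreAt_rho2'`; `thinFibreAt_of_domHyper` re-derives them.) -/
theorem residue_exhibits_domHyper :
    DomHyper (xPolyP 2 rho1') ∧ DomHyper (xPolyP 2 rho2') ∧ DomHyper (xPolyP 2 rho3) ∧
      (∀ m₀, ThinFibreAt m₀ (xPolyP 2 rho3)) ∧ LevelFinite (xPolyP 2 rho3) ∧ BddLevelEmpty (xPolyP 2 rho3) :=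
  ⟨domHyper_rho1', domHyper_rho2', domHyper_rho3, thinFibreAt_rho3_dom2, levelFinite_rho3_dom2, bddLevelEmpty_rho3_dom2⟩

end Summit.Schanuel.Schanuel.Theorems.RootDecomp1KResidueDomHyper
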